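import Literature.MathematicalPhysics.QuantumFieldTheory.OSGlaserVectors
import Literature.Analysis.Complex.HolomorphicParametricIntegral
import Mathlib.Analysis.Complex.LocallyUniformLimit
import Mathlib.MeasureTheory.Measure.Lebesgue.EqHaar
import HarnessLib

/-!
# Glaser vectors in the OS Hilbert space, II: holomorphic families and the Euclidean end

Second support file (everything proved, no named facts) of the route to
`Literature.MathematicalPhysics.QuantumFieldTheory.OS1973_cluster` through the Glaser vectors of
`OSGlaserVectors` (V. Glaser, Comm. Math. Phys. 37 (1974), §2; Osterwalder–Schrader I (1973),
§4.3). The kernel identities `⟪b_σ, b_τ⟫ = 𝕂(σ, τ)` for ray smearings are obtained (in the sequel)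
by analytic continuation in a deformation parameter from *Euclidean* smearings, where the Glaser
vectors are honest vectors `δ_g` of the OS pre-Hilbert space. This file supplies:

* `differentiableOn_of_tendstoLocallyUniformlyOn_inner` / `differentiableOn_inner_of_subset_closure`
  — weak holomorphy: a locally bounded Hilbert-space valued map whose inner products against a
  subspace are holomorphic has holomorphic inner products against the closure of the subspace;
* `SmearingFamily` — holomorphic one-parameter families `μ ↦ σ_μ` of smearings (same weight),
  `differentiableOn_smKernel_at` — `μ ↦ 𝕂(τ, σ_μ)` is holomorphic (dominated holomorphic
  parameter integrals, `Literature.Analysis.Complex.differentiableOn_integral_of_dominated`),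
  `differentiableOn_inner_glaserVec_at` — `μ ↦ ⟪x, b_{σ_μ}⟫` is holomorphic for `x ∈ ℋ₀`;
* `timeScale`, `timeScalePi`, `integral_comp_timeAffine` — the time-scaling affine change of
  variables `y_k = (ν u⁰_k + c_k, u⃗_k)`, `∫ f(y) dy = |ν|^m ∫ f(A u) du`;
* `rayFam` — the deformation `μ ↦ (μ u⁰_k + i s (k+1), u⃗_k)` of the ray points `x + isη`
  (`μ = 1`) into Euclidean points (`μ = iν`), and **the Euclidean end**
  (`smKernel_rayFam_at_I_mul_left/right`, `glaserVec_rayFam_at_I_mul`): at `μ = iν` the smeared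
  kernel is that of the Euclidean smearing of the pushed-forward test function
  `g(y) = ν^{-m} G(A⁻¹ y)`, so the Glaser vector *is* the basis vector `δ_g`.

## References

* V. Glaser, Comm. Math. Phys. 37 (1974) 257–272, §2. [GlaserCMP1974]
* K. Osterwalder, R. Schrader, Comm. Math. Phys. 31 (1973) 83–112, §4.3. [OsterwalderSchraderCMP1973]
-/

noncomputable section

open MeasureTheory Filter Complex ComplexConjugate Metric Set
open scoped Topology ComplexOrder SchwartzMap BigOperators InnerProductSpace

namespace Literature.MathematicalPhysics.QuantumFieldTheory

open Literature.MathematicalPhysics.QuantumLattice Literature.Analysis.Complex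

variable {d : ℕ}

/-! ### Weak holomorphy of locally bounded Hilbert-space valued maps -/

section WeakHolomorphy

variable {H : Type*} [NormedAddCommGroup H] [InnerProductSpace ℂ H]

/-- **Weak holomorphy passes to limits of the test vectors**: if `B : ℂ → H` is locally bounded on
the open set `V`, `xⱼ → x`, and each `μ ↦ ⟪xⱼ, B μ⟫` is holomorphic on `V`, then so is
`μ ↦ ⟪x, B μ⟫` (locally uniform convergence). [folklore] -/
theorem differentiableOn_inner_of_tendsto {V : Set ℂ} (hV : IsOpen V) {B : ℂ → H}
    (hB : ∀ μ₀ ∈ V, ∃ r > 0, ∃ C : ℝ, ∀ μ ∈ ball μ₀ r, ‖B μ‖ ≤ C)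
    {x : ℕ → H} {x₀ : H} (hx : Tendsto x atTop (𝓝 x₀))
    (hhol : ∀ j, DifferentiableOn ℂ (fun μ => ⟪x j, B μ⟫_ℂ) V) :
    DifferentiableOn ℂ (fun μ => ⟪x₀, B μ⟫_ℂ) V := by
  have hunif : TendstoLocallyUniformlyOn (fun j μ => ⟪x j, B μ⟫_ℂ) (fun μ => ⟪x₀, B μ⟫_ℂ) atTop V := by
    rw [Metric.tendstoLocallyUniformlyOn_iff]
    intro ε hε μ₀ hμ₀
    obtain ⟨r, hr, C, hC⟩ := hB μ₀ hμ₀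
    refine ⟨ball μ₀ r, mem_nhdsWithin_of_mem_nhds (ball_mem_nhds _ hr), ?_⟩
    have hC0 : 0 ≤ C := (norm_nonneg _).trans (hC μ₀ (mem_ball_self hr))
    have hδ : 0 < ε / (C + 1) := by positivity
    have hev : ∀ᶠ j in atTop, dist (x j) x₀ < ε / (C + 1) := (Metric.tendsto_nhds.1 hx) _ hδ
    filter_upwards [hev] with j hj y hy
    rw [dist_eq_norm] at hj
    rw [dist_eq_norm, ← inner_sub_left]
    calc ‖⟪x₀ - x j, B y⟫_ℂ‖ ≤ ‖x₀ - x j‖ * ‖B y‖ := norm_inner_le_norm _ _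
      _ ≤ ε / (C + 1) * C := by
          rw [norm_sub_rev]
          exact mul_le_mul hj.le (hC y hy) (norm_nonneg _) hδ.le
      _ < ε := by
          rw [div_mul_eq_mul_div, div_lt_iff₀ (by positivity)]
          nlinarith
  exact hunif.differentiableOn (Eventually.of_forall hhol) hV

/-- **Weak holomorphy against the closure**: if `B : ℂ → H` is locally bounded on the open set
`V` and `μ ↦ ⟪v, B μ⟫` is holomorphic on `V` for every `v` in a set `K`, then `μ ↦ ⟪x, B μ⟫` is
holomorphic on `V` for every `x` in the closure of `K`. [folklore] -/
theorem differentiableOn_inner_of_mem_closure {V : Set ℂ} (hV : IsOpen V) {B : ℂ → H}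
    (hB : ∀ μ₀ ∈ V, ∃ r > 0, ∃ C : ℝ, ∀ μ ∈ ball μ₀ r, ‖B μ‖ ≤ C)
    {K : Set H} (hhol : ∀ v ∈ K, DifferentiableOn ℂ (fun μ => ⟪v, B μ⟫_ℂ) V)
    {x : H} (hx : x ∈ closure K) :
    DifferentiableOn ℂ (fun μ => ⟪x, B μ⟫_ℂ) V := by
  obtain ⟨u, hu, hux⟩ := mem_closure_iff_seq_limit.1 hx
  exact differentiableOn_inner_of_tendsto hV hB hux fun j => hhol _ (hu j)

end WeakHolomorphy

/-! ### Continuity of kernel integrands -/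

section Integrand

/-- A kernel continuous on an open product set, multiplied by weights supported inside, is a
globally continuous integrand. [folklore] -/
theorem continuous_kernel_mul_weights {X Y : Type*} [TopologicalSpace X] [TopologicalSpace Y]
    {κ : X × Y → ℂ} {A : Set X} {B : Set Y} (hA : IsOpen A) (hB : IsOpen B)
    (hκ : ContinuousOn κ (A ×ˢ B)) {f : X → ℂ} {g : Y → ℂ} (hf : Continuous f) (hg : Continuous g)
    (hfA : tsupport f ⊆ A) (hgB : tsupport g ⊆ B) :
    Continuous fun zz : X × Y => κ zz * (conj (f zz.1) * g zz.2) := by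
  rw [continuous_iff_continuousAt]
  intro zz
  by_cases hzz : zz ∈ A ×ˢ B
  · exact (hκ.continuousAt ((hA.prod hB).mem_nhds hzz)).mul
      (((continuous_conj.comp (hf.comp continuous_fst)).mul (hg.comp continuous_snd)).continuousAt)
  · have hev : (fun zz : X × Y => κ zz * (conj (f zz.1) * g zz.2)) =ᶠ[𝓝 zz] fun _ => 0 := by
      rw [Set.mem_prod, not_and_or] at hzz
      rcases hzz with h | h
      · have h1 : zz.1 ∉ tsupport f := fun h' => h (hfA h')
        have : ∀ᶠ ww in 𝓝 zz, f ww.1 = 0 :=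
          (continuousAt_fst (p := zz)).eventually (notMem_tsupport_iff_eventuallyEq.1 h1)
        filter_upwards [this] with ww hww
        simp [hww]
      · have h1 : zz.2 ∉ tsupport g := fun h' => h (hgB h')
        have : ∀ᶠ ww in 𝓝 zz, g ww.2 = 0 :=
          (continuousAt_snd (p := zz)).eventually (notMem_tsupport_iff_eventuallyEq.1 h1)
        filter_upwards [this] with ww hww
        simp [hww]
    exact continuousAt_const.congr hev.symm

/-- … and has compact support. [folklore] -/
theorem hasCompactSupport_kernel_mul_weights {X Y : Type*} [TopologicalSpace X] [TopologicalSpace Y]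
    (κ : X × Y → ℂ) {f : X → ℂ} {g : Y → ℂ} (hf : HasCompactSupport f) (hg : HasCompactSupport g) :
    HasCompactSupport fun zz : X × Y => κ zz * (conj (f zz.1) * g zz.2) := by
  refine HasCompactSupport.intro' (hf.isCompact.prod hg.isCompact)
    ((isClosed_tsupport _).prod (isClosed_tsupport _)) fun zz hzz => ?_
  rw [Set.mem_prod, not_and_or] at hzz
  rcases hzz with h | h
  · simp [image_eq_zero_of_notMem_tsupport h]
  · simp [image_eq_zero_of_notMem_tsupport h]

end Integrand

/-! ### Holomorphic families of smearings -/

section Family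

variable {m n : ℕ}

/-- The zero ray smearing (a junk default). [folklore] -/
def Smearing.zero (d m : ℕ) : Smearing d m :=
  Smearing.ofRay one_pos (fun _ => 0) continuous_const HasCompactSupport.zero

variable (d m) in
/-- A **holomorphic family of smearings** `μ ↦ σ_μ = (φ_μ, w)`, `μ ∈ V`: the parametrisations
depend jointly continuously on `(μ, u) ∈ V × U` and holomorphically on `μ`, the weight is fixed. [folklore] -/
structure SmearingFamily where
  /-- The parametrisations. -/
  φ : ℂ → (Fin m → SpaceTime d) → (Fin m → Fin (d + 1) → ℂ)
  /-- The common weight. -/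
  w : (Fin m → SpaceTime d) → ℂ
  /-- The parameter domain of the configurations. -/
  U : Set (Fin m → SpaceTime d)
  /-- The domain of the deformation parameter. -/
  V : Set ℂ
  isOpen_V : IsOpen V
  isOpen_U : IsOpen U
  nonempty_U : U.Nonempty
  continuousOn_φ : ContinuousOn (fun p : ℂ × (Fin m → SpaceTime d) => φ p.1 p.2) (V ×ˢ U)
  differentiableOn_φ : ∀ u ∈ U, DifferentiableOn ℂ (fun μ => φ μ u) V
  mem_mixedPts : ∀ μ ∈ V, ∀ u ∈ U, (⟨m, φ μ u⟩ : Σ n, (Fin n → Fin (d + 1) → ℂ)) ∈ mixedPts d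
  continuous_w : Continuous w
  hasCompactSupport_w : HasCompactSupport w
  tsupport_subset : tsupport w ⊆ U

namespace SmearingFamily

variable (f : SmearingFamily d m)

/-- The smearing `σ_μ` of the family at a parameter `μ ∈ V` (junk outside `V`). [folklore] -/
def eval (μ : ℂ) : Smearing d m := by
  classical
  exact if hμ : μ ∈ f.V then
    { φ := f.φ μ
      w := f.w
      U := f.U
      isOpen_U := f.isOpen_U
      nonempty_U := f.nonempty_U
      continuousOn_φ := f.continuousOn_φ.comp (Continuous.prodMk_right μ).continuousOn
        fun u hu => ⟨hμ, hu⟩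
      mem_mixedPts := f.mem_mixedPts μ hμ
      continuous_w := f.continuous_w
      hasCompactSupport_w := f.hasCompactSupport_w
      tsupport_subset := f.tsupport_subset }
  else Smearing.zero d m

/-- The parametrisation at `μ ∈ V`. [folklore] -/
@[simp] theorem eval_φ {μ : ℂ} (hμ : μ ∈ f.V) : (f.eval μ).φ = f.φ μ := by
  rw [SmearingFamily.eval, dif_pos hμ]

/-- The weight at `μ ∈ V`. [folklore] -/
@[simp] theorem eval_w {μ : ℂ} (hμ : μ ∈ f.V) : (f.eval μ).w = f.w := by
  rw [SmearingFamily.eval, dif_pos hμ]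

end SmearingFamily

variable {𝔚 : (n : ℕ) → (Fin n → Fin (d + 1) → ℂ) → ℂ}

/-- The smeared kernel written as one integral over the product space. [folklore] -/
theorem smKernel_eq_integral_prod
    (hcont : ∀ p q, ContinuousOn (fun zz : (Fin p → Fin (d + 1) → ℂ) × (Fin q → Fin (d + 1) → ℂ) =>
        osKernel 𝔚 ⟨p, zz.1⟩ ⟨q, zz.2⟩)
      {zz | (⟨p, zz.1⟩ : Σ n, (Fin n → Fin (d + 1) → ℂ)) ∈ mixedPts d ∧
        (⟨q, zz.2⟩ : Σ n, (Fin n → Fin (d + 1) → ℂ)) ∈ mixedPts d})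
    (σ : Smearing d n) (τ : Smearing d m) :
    (Continuous fun zz : (Fin n → SpaceTime d) × (Fin m → SpaceTime d) =>
        osKernel 𝔚 ⟨n, σ.φ zz.1⟩ ⟨m, τ.φ zz.2⟩ * (conj (σ.w zz.1) * τ.w zz.2)) ∧
    smKernel 𝔚 ⟨n, σ⟩ ⟨m, τ⟩ =
      ∫ zz : (Fin n → SpaceTime d) × (Fin m → SpaceTime d),
        osKernel 𝔚 ⟨n, σ.φ zz.1⟩ ⟨m, τ.φ zz.2⟩ * (conj (σ.w zz.1) * τ.w zz.2) ∂(volume.prod volume) := by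
  have hκ : ContinuousOn (fun zz : (Fin n → SpaceTime d) × (Fin m → SpaceTime d) =>
      osKernel 𝔚 ⟨n, σ.φ zz.1⟩ ⟨m, τ.φ zz.2⟩) (σ.U ×ˢ τ.U) :=
    (hcont n m).comp ((σ.continuousOn_φ.comp continuousOn_fst fun zz hzz => hzz.1).prodMk
      (τ.continuousOn_φ.comp continuousOn_snd fun zz hzz => hzz.2))
      fun zz hzz => ⟨σ.mem_mixedPts _ hzz.1, τ.mem_mixedPts _ hzz.2⟩
  have hc := continuous_kernel_mul_weights (κ := fun zz : (Fin n → SpaceTime d) × (Fin m → SpaceTime d) =>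
      osKernel 𝔚 ⟨n, σ.φ zz.1⟩ ⟨m, τ.φ zz.2⟩) σ.isOpen_U τ.isOpen_U hκ σ.continuous_w τ.continuous_w
    σ.tsupport_subset τ.tsupport_subset
  have hK := hasCompactSupport_kernel_mul_weights (fun zz : (Fin n → SpaceTime d) × (Fin m → SpaceTime d) =>
      osKernel 𝔚 ⟨n, σ.φ zz.1⟩ ⟨m, τ.φ zz.2⟩) σ.hasCompactSupport_w τ.hasCompactSupport_w
  exact ⟨hc, (integral_prod _ (hc.integrable_of_hasCompactSupport hK)).symm⟩

/-- **Bound on the smeared kernel from a bound on the kernel over the supports.** [folklore] -/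
theorem norm_smKernel_le (σ : Smearing d n) (τ : Smearing d m) {M : ℝ}
    (hb : ∀ u ∈ tsupport σ.w, ∀ u' ∈ tsupport τ.w, ‖osKernel 𝔚 ⟨n, σ.φ u⟩ ⟨m, τ.φ u'⟩‖ ≤ M) :
    ‖smKernel 𝔚 ⟨n, σ⟩ ⟨m, τ⟩‖ ≤ M * (∫ u, ‖σ.w u‖) * ∫ u', ‖τ.w u'‖ := by
  rw [smKernel_apply]
  have hin : ∀ u, ‖∫ u', osKernel 𝔚 ⟨n, σ.φ u⟩ ⟨m, τ.φ u'⟩ * (conj (σ.w u) * τ.w u')‖ ≤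
      M * ‖σ.w u‖ * ∫ u', ‖τ.w u'‖ := by
    intro u
    rw [← integral_const_mul]
    refine norm_integral_le_of_norm_le ((τ.continuous_w.norm.integrable_of_hasCompactSupport
      τ.hasCompactSupport_w.norm).const_mul _) (Eventually.of_forall fun u' => ?_)
    by_cases hu : u ∈ tsupport σ.w
    · by_cases hu' : u' ∈ tsupport τ.w
      · rw [norm_mul, norm_mul, Complex.norm_conj]
        calc ‖osKernel 𝔚 ⟨n, σ.φ u⟩ ⟨m, τ.φ u'⟩‖ * (‖σ.w u‖ * ‖τ.w u'‖)
            ≤ M * (‖σ.w u‖ * ‖τ.w u'‖) :=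
              mul_le_mul_of_nonneg_right (hb u hu u' hu') (by positivity)
          _ = M * ‖σ.w u‖ * ‖τ.w u'‖ := by ring
      · simp only [image_eq_zero_of_notMem_tsupport hu', mul_zero, norm_zero]
        positivity
    · simp only [image_eq_zero_of_notMem_tsupport hu, map_zero, zero_mul, mul_zero, norm_zero]
      positivity
  calc ‖∫ u, ∫ u', osKernel 𝔚 ⟨n, σ.φ u⟩ ⟨m, τ.φ u'⟩ * (conj (σ.w u) * τ.w u')‖
      ≤ ∫ u, M * ‖σ.w u‖ * ∫ u', ‖τ.w u'‖ :=
        norm_integral_le_of_norm_le (((σ.continuous_w.norm.integrable_of_hasCompactSupport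
          σ.hasCompactSupport_w.norm).const_mul M).mul_const _) (Eventually.of_forall hin)
    _ = M * (∫ u, ‖σ.w u‖) * ∫ u', ‖τ.w u'‖ := by
        rw [integral_mul_const, integral_const_mul]

variable {S : SchwingerFamily (EuclideanSpace ℝ (Fin (d + 1)))}

/-- **Holomorphy of the smeared kernel along a holomorphic family**: `μ ↦ 𝕂(τ, σ_μ)` is
holomorphic on `V` (dominated holomorphic parameter integral; the kernel is holomorphic in its
second argument on the relative tube). [folklore] -/
theorem GlaserHyp.differentiableOn_smKernel_eval (h : GlaserHyp S 𝔚) (τ : Smearing d n)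
    (f : SmearingFamily d m) :
    DifferentiableOn ℂ (fun μ => smKernel 𝔚 ⟨n, τ⟩ ⟨m, f.eval μ⟩) f.V := by
  -- the integrand on the product space
  set G : ℂ → (Fin n → SpaceTime d) × (Fin m → SpaceTime d) → ℂ := fun μ zz =>
    osKernel 𝔚 ⟨n, τ.φ zz.1⟩ ⟨m, f.φ μ zz.2⟩ * (conj (τ.w zz.1) * f.w zz.2) with hG
  have heq : ∀ μ ∈ f.V, smKernel 𝔚 ⟨n, τ⟩ ⟨m, f.eval μ⟩ = ∫ zz, G μ zz ∂(volume.prod volume) := by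
    intro μ hμ
    rw [(smKernel_eq_integral_prod h.continuousOn_osKernel τ (f.eval μ)).2]
    simp [hG, f.eval_φ hμ, f.eval_w hμ]
  have hGc : ∀ μ ∈ f.V, Continuous (G μ) := by
    intro μ hμ
    have := (smKernel_eq_integral_prod h.continuousOn_osKernel τ (f.eval μ)).1
    simpa [hG, f.eval_φ hμ, f.eval_w hμ] using this
  refine (differentiableOn_integral_of_dominated (F := G) (U := f.V) (μ := volume.prod volume)
    (fun μ hμ => (hGc μ hμ).aestronglyMeasurable) ?_ ?_).congr heq
  · -- holomorphy in `μ` for every point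
    refine Eventually.of_forall fun zz => ?_
    by_cases hzz : zz.1 ∈ tsupport τ.w ∧ zz.2 ∈ tsupport f.w
    · have hu : zz.1 ∈ τ.U := τ.tsupport_subset hzz.1
      have hu' : zz.2 ∈ f.U := f.tsupport_subset hzz.2
      have hker : DifferentiableOn ℂ (fun μ => osKernel 𝔚 ⟨n, τ.φ zz.1⟩ ⟨m, f.φ μ zz.2⟩) f.V := by
        intro μ hμ
        have happ : DifferentiableOn ℂ
            (fun μ => Fin.append (revConj (τ.φ zz.1)) (f.φ μ zz.2)) f.V := by
          rw [differentiableOn_pi]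
          intro k
          induction k using Fin.addCases with
          | left i => simp only [Fin.append_left]; exact differentiableOn_const _
          | right j =>
            simp only [Fin.append_right]
            exact (differentiableOn_pi.1 (f.differentiableOn_φ _ hu')) j
        have hrel : Fin.append (revConj (τ.φ zz.1)) (f.φ μ zz.2) ∈ relForwardTube d (n + m) :=
          append_revConj_mem_relForwardTube_of_mem_mixedPts (τ.mem_mixedPts _ hu)
            (f.mem_mixedPts μ hμ _ hu')
        have hdiff := differentiableAt_tubeExtension (h.differentiableOn (n + m)) (h.timeShift (n + m)) hrel
        exact (hdiff.comp_differentiableWithinAt μ (happ μ hμ)).congr (fun μ' _ => rfl) rfl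
      exact hker.mul (differentiableOn_const _)
    · have h0 : ∀ μ, G μ zz = 0 := by
        intro μ
        rw [not_and_or] at hzz
        rcases hzz with h1 | h1
        · simp [hG, image_eq_zero_of_notMem_tsupport h1]
        · simp [hG, image_eq_zero_of_notMem_tsupport h1]
      simp only [h0]
      exact differentiableOn_const _
  · -- local domination
    intro μ₀ hμ₀
    obtain ⟨R, hR, hRV⟩ := Metric.isOpen_iff.1 f.isOpen_V μ₀ hμ₀
    have hsub : closedBall μ₀ (R / 2) ⊆ f.V := (closedBall_subset_ball (by linarith)).trans hRV
    -- the kernel is bounded on `closedBall × tsupport × tsupport`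
    have hcpt : IsCompact (closedBall μ₀ (R / 2) ×ˢ (tsupport τ.w ×ˢ tsupport f.w)) :=
      (isCompact_closedBall _ _).prod (τ.hasCompactSupport_w.prod f.hasCompactSupport_w)
    have hcontK : ContinuousOn (fun p : ℂ × ((Fin n → SpaceTime d) × (Fin m → SpaceTime d)) =>
        osKernel 𝔚 ⟨n, τ.φ p.2.1⟩ ⟨m, f.φ p.1 p.2.2⟩)
        (closedBall μ₀ (R / 2) ×ˢ (tsupport τ.w ×ˢ tsupport f.w)) := by
      have h1 : ContinuousOn (fun p : ℂ × ((Fin n → SpaceTime d) × (Fin m → SpaceTime d)) => τ.φ p.2.1)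
          (closedBall μ₀ (R / 2) ×ˢ (tsupport τ.w ×ˢ tsupport f.w)) :=
        τ.continuousOn_φ.comp (continuous_fst.comp continuous_snd).continuousOn
          fun p hp => τ.tsupport_subset hp.2.1
      have h2 : ContinuousOn (fun p : ℂ × ((Fin n → SpaceTime d) × (Fin m → SpaceTime d)) => f.φ p.1 p.2.2)
          (closedBall μ₀ (R / 2) ×ˢ (tsupport τ.w ×ˢ tsupport f.w)) :=
        f.continuousOn_φ.comp (f := fun p : ℂ × ((Fin n → SpaceTime d) × (Fin m → SpaceTime d)) => (p.1, p.2.2))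
          (continuous_fst.prodMk (continuous_snd.comp continuous_snd)).continuousOn
          fun p hp => ⟨hsub hp.1, f.tsupport_subset hp.2.2⟩
      refine (h.continuousOn_osKernel n m).comp (h1.prodMk h2) fun p hp => ?_
      exact ⟨τ.mem_mixedPts _ (τ.tsupport_subset hp.2.1),
        f.mem_mixedPts _ (hsub hp.1) _ (f.tsupport_subset hp.2.2)⟩
    obtain ⟨M, hM⟩ := hcpt.exists_bound_of_continuousOn hcontK
    refine ⟨R / 2, by linarith, (ball_subset_closedBall).trans hsub,
      fun zz => |M| * (‖τ.w zz.1‖ * ‖f.w zz.2‖), ?_, ?_⟩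
    · have hc : Continuous fun zz : (Fin n → SpaceTime d) × (Fin m → SpaceTime d) =>
          |M| * (‖τ.w zz.1‖ * ‖f.w zz.2‖) :=
        continuous_const.mul ((τ.continuous_w.norm.comp continuous_fst).mul
          (f.continuous_w.norm.comp continuous_snd))
      refine hc.integrable_of_hasCompactSupport ?_
      refine HasCompactSupport.intro' (τ.hasCompactSupport_w.prod f.hasCompactSupport_w)
        ((isClosed_tsupport _).prod (isClosed_tsupport _)) fun zz hzz => ?_
      rw [Set.mem_prod, not_and_or] at hzz
      rcases hzz with h1 | h1
      · simp [image_eq_zero_of_notMem_tsupport h1]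
      · simp [image_eq_zero_of_notMem_tsupport h1]
    · refine Eventually.of_forall fun zz μ hμ => ?_
      by_cases hzz : zz.1 ∈ tsupport τ.w ∧ zz.2 ∈ tsupport f.w
      · simp only [hG, norm_mul, Complex.norm_conj]
        refine mul_le_mul_of_nonneg_right ?_ (by positivity)
        exact (hM ⟨μ, zz⟩ ⟨ball_subset_closedBall hμ, hzz.1, hzz.2⟩).trans (le_abs_self M)
      · rw [not_and_or] at hzz
        rcases hzz with h1 | h1
        · simp only [hG, image_eq_zero_of_notMem_tsupport h1, map_zero, zero_mul, mul_zero, norm_zero]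
          positivity
        · simp only [hG, image_eq_zero_of_notMem_tsupport h1, mul_zero, norm_zero]
          positivity


/-! ### Local bounds and weak holomorphy of the Glaser vectors along a family -/

variable [NeZero d]

/-- **Local boundedness of the Glaser vectors along a holomorphic family.** [folklore] -/
theorem GlaserHyp.exists_norm_glaserVec_eval_le (h : GlaserHyp S 𝔚) (hE2 : S.IsOSReflectionPositive)
    (f : SmearingFamily d m) {μ₀ : ℂ} (hμ₀ : μ₀ ∈ f.V) :
    ∃ r > 0, ∃ C : ℝ, ∀ μ ∈ ball μ₀ r, ‖h.glaserVec hE2 ⟨m, f.eval μ⟩‖ ≤ C := by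
  obtain ⟨R, hR, hRV⟩ := Metric.isOpen_iff.1 f.isOpen_V μ₀ hμ₀
  have hsub : closedBall μ₀ (R / 2) ⊆ f.V := (closedBall_subset_ball (by linarith)).trans hRV
  have hcpt : IsCompact (closedBall μ₀ (R / 2) ×ˢ (tsupport f.w ×ˢ tsupport f.w)) :=
    (isCompact_closedBall _ _).prod (f.hasCompactSupport_w.prod f.hasCompactSupport_w)
  have hcontK : ContinuousOn (fun p : ℂ × ((Fin m → SpaceTime d) × (Fin m → SpaceTime d)) =>
      osKernel 𝔚 ⟨m, f.φ p.1 p.2.1⟩ ⟨m, f.φ p.1 p.2.2⟩)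
      (closedBall μ₀ (R / 2) ×ˢ (tsupport f.w ×ˢ tsupport f.w)) := by
    have h1 : ContinuousOn (fun p : ℂ × ((Fin m → SpaceTime d) × (Fin m → SpaceTime d)) => f.φ p.1 p.2.1)
        (closedBall μ₀ (R / 2) ×ˢ (tsupport f.w ×ˢ tsupport f.w)) :=
      f.continuousOn_φ.comp (f := fun p : ℂ × ((Fin m → SpaceTime d) × (Fin m → SpaceTime d)) => (p.1, p.2.1))
        (continuous_fst.prodMk (continuous_fst.comp continuous_snd)).continuousOn
        fun p hp => ⟨hsub hp.1, f.tsupport_subset hp.2.1⟩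
    have h2 : ContinuousOn (fun p : ℂ × ((Fin m → SpaceTime d) × (Fin m → SpaceTime d)) => f.φ p.1 p.2.2)
        (closedBall μ₀ (R / 2) ×ˢ (tsupport f.w ×ˢ tsupport f.w)) :=
      f.continuousOn_φ.comp (f := fun p : ℂ × ((Fin m → SpaceTime d) × (Fin m → SpaceTime d)) => (p.1, p.2.2))
        (continuous_fst.prodMk (continuous_snd.comp continuous_snd)).continuousOn
        fun p hp => ⟨hsub hp.1, f.tsupport_subset hp.2.2⟩
    refine (h.continuousOn_osKernel m m).comp (h1.prodMk h2) fun p hp => ?_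
    exact ⟨f.mem_mixedPts _ (hsub hp.1) _ (f.tsupport_subset hp.2.1),
      f.mem_mixedPts _ (hsub hp.1) _ (f.tsupport_subset hp.2.2)⟩
  obtain ⟨M, hM⟩ := hcpt.exists_bound_of_continuousOn hcontK
  refine ⟨R / 2, by linarith, Real.sqrt (|M| * (∫ u, ‖f.w u‖) * ∫ u, ‖f.w u‖), fun μ hμ => ?_⟩
  have hμV : μ ∈ f.V := hsub (ball_subset_closedBall hμ)
  have hK : ‖smKernel 𝔚 ⟨m, f.eval μ⟩ ⟨m, f.eval μ⟩‖ ≤ |M| * (∫ u, ‖f.w u‖) * ∫ u, ‖f.w u‖ := by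
    have := norm_smKernel_le (𝔚 := 𝔚) (f.eval μ) (f.eval μ) (M := |M|) (fun u hu u' hu' => by
      rw [f.eval_w hμV] at hu hu'
      rw [f.eval_φ hμV]
      exact (hM ⟨μ, (u, u')⟩ ⟨ball_subset_closedBall hμ, hu, hu'⟩).trans (le_abs_self M))
    simpa [f.eval_w hμV] using this
  rw [← Real.sqrt_sq (norm_nonneg _)]
  exact Real.sqrt_le_sqrt ((h.norm_glaserVec_sq_le hE2 _).trans ((Complex.re_le_norm _).trans hK))

open Literature.MathematicalPhysics.QuantumLattice.SchwingerFamily (OSSpace OSHilbert PosGen genPairing)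
open Literature.MathematicalPhysics.QuantumLattice.SchwingerFamily.OSSpace

/-- **Weak holomorphy of the Glaser vectors along a holomorphic family**: for `x ∈ ℋ₀`,
`μ ↦ ⟪x, b_{σ_μ}⟫` is holomorphic on `V`. [folklore] -/
theorem GlaserHyp.differentiableOn_inner_glaserVec_eval (h : GlaserHyp S 𝔚) (hE2 : S.IsOSReflectionPositive)
    (f : SmearingFamily d m) {x : OSHilbert S hE2} (hx : x ∈ niceClosure S hE2) :
    DifferentiableOn ℂ (fun μ => ⟪x, h.glaserVec hE2 ⟨m, f.eval μ⟩⟫_ℂ) f.V := by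
  have hx' : x ∈ closure (((niceModule S hE2).map (ι S hE2).toLinearMap : Submodule ℂ _) : Set (OSHilbert S hE2)) := by
    rw [← Submodule.topologicalClosure_coe]; exact hx
  refine differentiableOn_inner_of_mem_closure f.isOpen_V
    (fun μ₀ hμ₀ => h.exists_norm_glaserVec_eval_le hE2 f hμ₀) ?_ hx'
  rintro v ⟨w, hw, rfl⟩
  have hw' := (mem_niceModule_iff w).1 hw
  -- expand `ι w` in the basis vectors
  have hexp : ∀ μ, ⟪ι S hE2 w, h.glaserVec hE2 ⟨m, f.eval μ⟩⟫_ℂ =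
      ∑ q ∈ ((OSSpace.of S hE2).symm w).support,
        conj ((OSSpace.of S hE2).symm w q) * conj ⟪h.glaserVec hE2 ⟨m, f.eval μ⟩, ι S hE2 (δ S hE2 q)⟫_ℂ := by
    intro μ
    conv_lhs => rw [eq_sum_smul_δ w, map_sum, sum_inner]
    refine Finset.sum_congr rfl fun q _ => ?_
    rw [map_smul, inner_smul_left, inner_conj_symm]
  have hexp' : ∀ μ ∈ f.V, ⟪ι S hE2 w, h.glaserVec hE2 ⟨m, f.eval μ⟩⟫_ℂ =
      ∑ q ∈ ((OSSpace.of S hE2).symm w).support.attach,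
        conj ((OSSpace.of S hE2).symm w q) *
          smKernel 𝔚 (Smearing.ofGen q (hw' (Finset.mem_coe.2 q.2))) ⟨m, f.eval μ⟩ := by
    intro μ _
    rw [hexp μ, ← Finset.sum_attach]
    refine Finset.sum_congr rfl fun q _ => ?_
    rw [h.inner_glaserVec_ι_δ hE2 _ q (hw' (Finset.mem_coe.2 q.2)), conj_smKernel (h.smKernel_posSemidef hE2)]
  refine (DifferentiableOn.fun_sum fun q _ => ?_).congr hexp'
  exact (h.differentiableOn_smKernel_eval (Smearing.ofGen (q : PosGen (d + 1)) (hw' (Finset.mem_coe.2 q.2))).2 f).const_mul _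

end Family

/-! ### The time-scaling affine change of variables -/

section TimeScale

variable {m : ℕ}

variable (d) in
/-- **Time scaling** `x ↦ (ν x⁰, x⃗)` on `ℝ^{1+d}`. [folklore] -/
def timeScale (ν : ℝ) : SpaceTime d →L[ℝ] SpaceTime d :=
  ContinuousLinearMap.id ℝ _ + (ν - 1) • (EuclideanSpace.proj (0 : Fin (d + 1))).smulRight (e₀ d)

/-- Components of `timeScale`. [folklore] -/
theorem timeScale_apply (ν : ℝ) (x : SpaceTime d) (i : Fin (d + 1)) :
    timeScale d ν x i = if i = 0 then ν * x 0 else x i := by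
  by_cases hi : i = 0
  · subst hi
    simp [timeScale, e₀_apply]; ring
  · simp [timeScale, e₀_apply, hi]

/-- `timeScale 1 = id`. [folklore] -/
theorem timeScale_one (x : SpaceTime d) : timeScale d 1 x = x := by
  ext i; rw [timeScale_apply]; split_ifs with hi
  · subst hi; ring
  · rfl

/-- `timeScale ν ∘ timeScale ν' = timeScale (ν ν')`. [folklore] -/
theorem timeScale_timeScale (ν ν' : ℝ) (x : SpaceTime d) :
    timeScale d ν (timeScale d ν' x) = timeScale d (ν * ν') x := by
  ext i
  by_cases hi : i = 0
  · subst hi; simp only [timeScale_apply, if_true]; ring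
  · simp only [timeScale_apply, if_neg hi]

/-- **`det timeScale ν = ν`** (conjugate to the diagonal map `diag(ν, 1, …, 1)` of `ℝ^{1+d}`). [folklore] -/
theorem det_timeScale (ν : ℝ) :
    LinearMap.det (timeScale d ν : SpaceTime d →ₗ[ℝ] SpaceTime d) = ν := by
  classical
  set c : Fin (d + 1) → ℝ := fun i => if i = 0 then ν else 1 with hc
  set D : (Fin (d + 1) → ℝ) →ₗ[ℝ] (Fin (d + 1) → ℝ) :=
    LinearMap.pi fun i => (c i • LinearMap.id) ∘ₗ LinearMap.proj i with hD
  set e : (Fin (d + 1) → ℝ) ≃ₗ[ℝ] SpaceTime d :=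
    (EuclideanSpace.equiv (Fin (d + 1)) ℝ).toLinearEquiv.symm with he
  have hconj : (timeScale d ν : SpaceTime d →ₗ[ℝ] SpaceTime d) = (e : _ →ₗ[ℝ] _) ∘ₗ D ∘ₗ (e.symm : _ →ₗ[ℝ] _) := by
    apply LinearMap.ext
    intro x
    ext i
    simp only [ContinuousLinearMap.coe_coe, timeScale_apply, LinearMap.coe_comp, LinearEquiv.coe_coe,
      Function.comp_apply, hD, hc, he]
    by_cases hi : i = 0
    · subst hi; simp
    · simp [hi]
  rw [hconj, LinearMap.det_conj, hD, LinearMap.det_pi]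
  simp only [LinearMap.det_smul, LinearMap.det_id, mul_one, Module.finrank_self, pow_one, hc]
  rw [Finset.prod_ite_eq']
  simp

variable (d m) in
/-- Time scaling of every point of a configuration. [folklore] -/
def timeScalePi (ν : ℝ) : (Fin m → SpaceTime d) →L[ℝ] (Fin m → SpaceTime d) :=
  ContinuousLinearMap.pi fun k => (timeScale d ν).comp (ContinuousLinearMap.proj k)

/-- Components of `timeScalePi`. [folklore] -/
@[simp] theorem timeScalePi_apply (ν : ℝ) (u : Fin m → SpaceTime d) (k : Fin m) :
    timeScalePi d m ν u k = timeScale d ν (u k) := rfl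

/-- **`det timeScalePi ν = ν^m`.** [folklore] -/
theorem det_timeScalePi (ν : ℝ) :
    LinearMap.det (timeScalePi d m ν : (Fin m → SpaceTime d) →ₗ[ℝ] (Fin m → SpaceTime d)) = ν ^ m := by
  have h1 : (timeScalePi d m ν : (Fin m → SpaceTime d) →ₗ[ℝ] (Fin m → SpaceTime d)) =
      LinearMap.pi fun k => (timeScale d ν : SpaceTime d →ₗ[ℝ] SpaceTime d) ∘ₗ LinearMap.proj k := by
    apply LinearMap.ext; intro u; rfl
  rw [h1, LinearMap.det_pi, Finset.prod_const, det_timeScale, Finset.card_univ, Fintype.card_fin]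

variable (d m) in
/-- `timeScalePi ν` as a continuous linear equivalence for `ν ≠ 0`. [folklore] -/
def timeScalePiEquiv (ν : ℝ) (hν : ν ≠ 0) : (Fin m → SpaceTime d) ≃L[ℝ] (Fin m → SpaceTime d) :=
  ContinuousLinearEquiv.equivOfInverse (timeScalePi d m ν) (timeScalePi d m ν⁻¹)
    (fun u => by funext k; simp [timeScale_timeScale, inv_mul_cancel₀ hν, timeScale_one])
    (fun u => by funext k; simp [timeScale_timeScale, mul_inv_cancel₀ hν, timeScale_one])

/-- `timeScalePiEquiv` is `timeScalePi`. [folklore] -/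
@[simp] theorem timeScalePiEquiv_apply (ν : ℝ) (hν : ν ≠ 0) (u : Fin m → SpaceTime d) :
    timeScalePiEquiv d m ν hν u = timeScalePi d m ν u := rfl

/-- The inverse of `timeScalePiEquiv ν` is `timeScalePi ν⁻¹`. [folklore] -/
@[simp] theorem timeScalePiEquiv_symm_apply (ν : ℝ) (hν : ν ≠ 0) (u : Fin m → SpaceTime d) :
    (timeScalePiEquiv d m ν hν).symm u = timeScalePi d m ν⁻¹ u := rfl

/-- **The time-affine change of variables**: `∫ g(A u) du = |ν^m|⁻¹ ∫ g(y) dy` for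
`A u = (ν u⁰_k + c_k)_k` (Lebesgue measure scales by `|det A| = |ν|^m` and is translation
invariant). [folklore] -/
theorem integral_comp_timeScalePi_add {E : Type*} [NormedAddCommGroup E] [NormedSpace ℝ E]
    {ν : ℝ} (hν : ν ≠ 0) (c : Fin m → SpaceTime d) (g : (Fin m → SpaceTime d) → E) :
    ∫ u, g (timeScalePi d m ν u + c) = |ν ^ m|⁻¹ • ∫ y, g y := by
  set e : (Fin m → SpaceTime d) ≃ᵐ (Fin m → SpaceTime d) :=
    (timeScalePiEquiv d m ν hν).toHomeomorph.toMeasurableEquiv with he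
  have hecoe : (e : (Fin m → SpaceTime d) → (Fin m → SpaceTime d)) = timeScalePi d m ν := rfl
  have hdet : LinearMap.det (timeScalePi d m ν : (Fin m → SpaceTime d) →ₗ[ℝ] (Fin m → SpaceTime d)) ≠ 0 := by
    rw [det_timeScalePi]; exact pow_ne_zero _ hν
  have hmap : Measure.map e volume = ENNReal.ofReal |(ν ^ m)⁻¹| • (volume : Measure (Fin m → SpaceTime d)) := by
    have := Measure.map_linearMap_addHaar_eq_smul_addHaar
      (μ := (volume : Measure (Fin m → SpaceTime d)))
      (f := (timeScalePi d m ν : (Fin m → SpaceTime d) →ₗ[ℝ] (Fin m → SpaceTime d))) hdet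
    rw [det_timeScalePi] at this
    rw [hecoe]
    exact this
  calc ∫ u, g (timeScalePi d m ν u + c)
      = ∫ u, (fun y => g (y + c)) (e u) := rfl
    _ = ∫ y, g (y + c) ∂(Measure.map e volume) := (integral_map_equiv (μ := volume) e (fun y => g (y + c))).symm
    _ = |ν ^ m|⁻¹ • ∫ y, g (y + c) := by
        rw [hmap, integral_smul_measure, ENNReal.toReal_ofReal (abs_nonneg _), abs_inv]
    _ = |ν ^ m|⁻¹ • ∫ y, g y := by rw [integral_add_right_eq_self]

end TimeScale

/-! ### The deformation of the rays into Euclidean points -/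

section RayFamily

variable {m n : ℕ}

variable (d m) in
/-- The deformed parametrisation `φ_μ(u)_k = (μ u⁰_k + i (s (k+1) + r), u⃗_k)`: the ray points
`u + i s η` (`η = stdDir`) shifted by the imaginary time `i r` at `μ = 1`, Euclidean points at
`μ = iν`. [folklore] -/
def rayFamφ (s r : ℝ) (μ : ℂ) (u : Fin m → SpaceTime d) : Fin m → Fin (d + 1) → ℂ :=
  fun k i => if i = 0 then μ * ((u k 0 : ℝ) : ℂ) + I * ((s * (((k : ℕ) : ℝ) + 1) + r : ℝ) : ℂ) else ((u k i : ℝ) : ℂ)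

/-- The Euclidean data of the deformed point: times `Im μ · u⁰_k + s (k+1) + r`, spatial parts of `u`. [folklore] -/
def rayFamY (s r : ℝ) (μ : ℂ) (u : Fin m → SpaceTime d) : Fin m → EuclideanSpace ℝ (Fin (d + 1)) :=
  fun k => u k + (μ.im * u k 0 + (s * (((k : ℕ) : ℝ) + 1) + r) - u k 0) • e₀ d

/-- Components of `rayFamY`. [folklore] -/
theorem rayFamY_apply (s r : ℝ) (μ : ℂ) (u : Fin m → SpaceTime d) (k : Fin m) (i : Fin (d + 1)) :
    rayFamY s r μ u k i = if i = 0 then μ.im * u k 0 + (s * (((k : ℕ) : ℝ) + 1) + r) else u k i := by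
  by_cases hi : i = 0
  · subst hi; simp [rayFamY, e₀_apply]
  · simp [rayFamY, e₀_apply, hi]

/-- **The deformed points are mixed points** `M(y, τ)` with `y = rayFamY`, `τ_k = Re μ · u⁰_k`. [folklore] -/
theorem rayFamφ_eq_mixedPoint (s r : ℝ) (μ : ℂ) (u : Fin m → SpaceTime d) :
    rayFamφ d m s r μ u = mixedPoint (rayFamY s r μ u) fun k => μ.re * u k 0 := by
  funext k i
  by_cases hi : i = 0
  · subst hi
    simp only [rayFamφ, if_true, mixedPoint, rayFamY_apply]
    conv_lhs => rw [← Complex.re_add_im μ]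
    push_cast
    ring
  · simp [rayFamφ, mixedPoint, rayFamY_apply, hi]

/-- The Euclidean data are time-ordered when `2 (R+1) |Im μ| < s`, `r ≥ 0` and `|u⁰_k| < R + 1`. [folklore] -/
theorem rayFamY_mem_timeOrderedRegion {s r R : ℝ} {μ : ℂ} (hμ : 2 * (R + 1) * |μ.im| < s) (hr : 0 ≤ r)
    {u : Fin m → SpaceTime d} (hu : ∀ k, |u k 0| < R + 1) (hR : 0 ≤ R) :
    rayFamY s r μ u ∈ timeOrderedRegion d m := by
  have hbound : ∀ k, |μ.im * u k 0| < s / 2 := by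
    intro k
    rw [abs_mul]
    have h1 : |μ.im| * |u k 0| ≤ |μ.im| * (R + 1) := mul_le_mul_of_nonneg_left (hu k).le (abs_nonneg _)
    nlinarith [abs_nonneg μ.im]
  have hs : 0 < s := lt_of_le_of_lt (by positivity) hμ
  refine ⟨fun k => ?_, fun i j hij => ?_⟩
  · rw [rayFamY_apply, if_pos rfl]
    have := hbound k
    have h2 : -(s / 2) < μ.im * u k 0 := (abs_lt.1 this).1
    have h3 : (0 : ℝ) ≤ (k : ℕ) := Nat.cast_nonneg _
    nlinarith [mul_nonneg hs.le h3]
  · simp only [rayFamY_apply, if_true]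
    have h1 := (abs_lt.1 (hbound i)).2
    have h2 := (abs_lt.1 (hbound j)).1
    have h3 : ((i : ℕ) : ℝ) + 1 ≤ (j : ℕ) := by
      have : (i : ℕ) < (j : ℕ) := hij
      exact_mod_cast this
    have h4 : (0 : ℝ) ≤ ((j : ℕ) : ℝ) - (i : ℕ) - 1 := by linarith
    nlinarith [mul_nonneg hs.le h4]

variable (d m) in
/-- The parameter strip `{2 (R+1) |Im μ| < s}`. [folklore] -/
def rayFamV (s R : ℝ) : Set ℂ := {μ | 2 * (R + 1) * |μ.im| < s}

variable (d m) in
/-- The configuration domain `{|u⁰_k| < R + 1}`. [folklore] -/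
def rayFamU (R : ℝ) : Set (Fin m → SpaceTime d) := {u | ∀ k, |u k 0| < R + 1}

/-- The strip is open. [folklore] -/
theorem isOpen_rayFamV (s R : ℝ) : IsOpen (rayFamV s R) :=
  isOpen_lt (continuous_const.mul (continuous_abs.comp Complex.continuous_im)) continuous_const

/-- The strip is convex. [folklore] -/
theorem convex_rayFamV (s R : ℝ) (hR : 0 ≤ R) : Convex ℝ (rayFamV s R) := by
  have : rayFamV s R = {μ : ℂ | |μ.im| < s / (2 * (R + 1))} := by
    ext μ; simp only [rayFamV, mem_setOf_eq]
    rw [lt_div_iff₀ (by positivity)]; ring_nf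
  rw [this]
  have h2 : {μ : ℂ | |μ.im| < s / (2 * (R + 1))} =
      Complex.imLm ⁻¹' Set.Ioo (-(s / (2 * (R + 1)))) (s / (2 * (R + 1))) := by
    ext μ; simp [abs_lt]
  rw [h2]
  exact (convex_Ioo _ _).linear_preimage _

/-- Real parameters lie in the strip (for `s > 0`). [folklore] -/
theorem ofReal_mem_rayFamV {s : ℝ} (hs : 0 < s) (R t : ℝ) : (t : ℂ) ∈ rayFamV s R := by
  simp [rayFamV, hs]

/-- `iν` lies in the strip when `2 (R+1) |ν| < s`. [folklore] -/
theorem I_mul_mem_rayFamV {s R ν : ℝ} (hν : 2 * (R + 1) * |ν| < s) : I * (ν : ℂ) ∈ rayFamV s R := by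
  simpa [rayFamV] using hν

/-- The configuration domain is open. [folklore] -/
theorem isOpen_rayFamU (R : ℝ) : IsOpen (rayFamU d m R) := by
  simp only [rayFamU, setOf_forall]
  refine isOpen_iInter_of_finite fun k => ?_
  exact isOpen_lt (continuous_abs.comp ((EuclideanSpace.proj (0 : Fin (d + 1))).continuous.comp
    (continuous_apply k))) continuous_const

/-- Continuity of the deformed parametrisation in `(μ, u)`. [folklore] -/
theorem continuous_rayFamφ (s r : ℝ) : Continuous fun p : ℂ × (Fin m → SpaceTime d) => rayFamφ d m s r p.1 p.2 := by
  refine continuous_pi fun k => continuous_pi fun i => ?_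
  by_cases hi : i = 0
  · subst hi
    simp only [rayFamφ, if_true]
    refine (continuous_fst.mul (Complex.continuous_ofReal.comp ?_)).add continuous_const
    exact (EuclideanSpace.proj (0 : Fin (d + 1))).continuous.comp ((continuous_apply k).comp continuous_snd)
  · simp only [rayFamφ, if_neg hi]
    exact Complex.continuous_ofReal.comp
      ((EuclideanSpace.proj i).continuous.comp ((continuous_apply k).comp continuous_snd))

/-- Holomorphy of the deformed parametrisation in `μ`. [folklore] -/
theorem differentiable_rayFamφ (s r : ℝ) (u : Fin m → SpaceTime d) :
    Differentiable ℂ fun μ => rayFamφ d m s r μ u := by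
  refine differentiable_pi.2 fun k => differentiable_pi.2 fun i => ?_
  by_cases hi : i = 0
  · subst hi
    simp only [rayFamφ, if_true]
    exact (differentiable_id.mul (differentiable_const _)).add (differentiable_const _)
  · simp only [rayFamφ, if_neg hi]
    exact differentiable_const _

/-- **The deformation family of a compactly supported weight** `G` (with `|u⁰_k| ≤ R` on its
support). [folklore] -/
def rayFam (s r R : ℝ) (hr : 0 ≤ r) (hR : 0 ≤ R) (G : (Fin m → SpaceTime d) → ℂ) (hG : Continuous G)
    (hGc : HasCompactSupport G) (hGR : ∀ u ∈ tsupport G, ∀ k, |u k 0| ≤ R) : SmearingFamily d m where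
  φ := rayFamφ d m s r
  w := G
  U := rayFamU d m R
  V := rayFamV s R
  isOpen_V := isOpen_rayFamV s R
  isOpen_U := isOpen_rayFamU R
  nonempty_U := ⟨0, fun k => by simp; positivity⟩
  continuousOn_φ := (continuous_rayFamφ s r).continuousOn
  differentiableOn_φ := fun u _ => (differentiable_rayFamφ s r u).differentiableOn
  mem_mixedPts := fun μ hμ u hu => ⟨rayFamY s r μ u, rayFamY_mem_timeOrderedRegion hμ hr hu hR, _,
    rayFamφ_eq_mixedPoint s r μ u⟩
  continuous_w := hG
  hasCompactSupport_w := hGc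
  tsupport_subset := fun u hu k => lt_of_le_of_lt (hGR u hu k) (by linarith)

variable (d m) in
/-- The common complex time direction `(1, 0, …, 0)` in every point. [folklore] -/
def timeDirC : Fin m → Fin (d + 1) → ℂ := fun _ i => if i = 0 then 1 else 0

/-- **At `μ = 1` the deformed points are the ray points** `u + i s η` **shifted by `i r`.** [folklore] -/
theorem rayFamφ_one (s r : ℝ) (u : Fin m → SpaceTime d) :
    rayFamφ d m s r 1 u = rayConfig (stdDir d m) u s + (I * r) • timeDirC d m := by
  funext k i
  rw [Pi.add_apply, Pi.add_apply, Pi.smul_apply, Pi.smul_apply, rayConfig_apply, stdDir_apply]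
  by_cases hi : i = 0
  · subst hi; simp [rayFamφ, timeDirC]; ring
  · simp [rayFamφ, timeDirC, hi]

/-- At `μ = 1`, `r = 0` the deformed points are the ray points. [folklore] -/
theorem rayFamφ_one_zero (s : ℝ) (u : Fin m → SpaceTime d) :
    rayFamφ d m s 0 1 u = rayConfig (stdDir d m) u s := by
  rw [rayFamφ_one]; simp

variable (d m) in
/-- The Euclidean time shifts `c_k = (s (k+1) + r) ê₀` of the ray family. [folklore] -/
def rayShiftVec (s r : ℝ) : Fin m → SpaceTime d := fun k => (s * (((k : ℕ) : ℝ) + 1) + r) • e₀ d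

/-- **At `μ = iν` the deformed points are the Euclidean points of the time-affine image**
`A u = (ν u⁰_k + s(k+1) + r, u⃗_k)`. [folklore] -/
theorem rayFamφ_I_mul (s r ν : ℝ) (u : Fin m → SpaceTime d) :
    rayFamφ d m s r (I * ν) u = euclideanPoint (timeScalePi d m ν u + rayShiftVec d m s r) := by
  funext k i
  by_cases hi : i = 0
  · subst hi
    simp [rayFamφ, euclideanPoint, timeScale_apply, rayShiftVec, e₀_apply]
    ring
  · simp [rayFamφ, euclideanPoint, timeScale_apply, rayShiftVec, e₀_apply, hi]

/-- The time-affine image of the support is time-ordered for small `ν`, `r ≥ 0`. [folklore] -/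
theorem timeScalePi_add_rayShiftVec_mem_timeOrderedRegion {s r R ν : ℝ}
    (hνs : 2 * (R + 1) * |ν| < s) (hr : 0 ≤ r) (hR : 0 ≤ R) {u : Fin m → SpaceTime d} (hu : ∀ k, |u k 0| ≤ R) :
    timeScalePi d m ν u + rayShiftVec d m s r ∈ timeOrderedRegion d m := by
  have heq : timeScalePi d m ν u + rayShiftVec d m s r = rayFamY s r (I * ν) u := by
    funext k; ext i
    rw [rayFamY_apply]
    by_cases hi : i = 0
    · subst hi; simp [timeScale_apply, rayShiftVec, e₀_apply]
    · simp [timeScale_apply, rayShiftVec, e₀_apply, hi]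
  rw [heq]
  exact rayFamY_mem_timeOrderedRegion (by simpa using hνs) hr (fun k => lt_of_le_of_lt (hu k) (by linarith)) hR

/-- **The pushed-forward test function** `g(y) = |ν^m|⁻¹ G(A⁻¹ y)`, `A u = timeScalePi ν u + c`. [folklore] -/
def pushTest (ν : ℝ) (hν : ν ≠ 0) (c : Fin m → SpaceTime d) (G : 𝓢((Fin m → SpaceTime d), ℂ)) :
    𝓢((Fin m → SpaceTime d), ℂ) :=
  ((|ν ^ m|⁻¹ : ℝ) : ℂ) • SchwartzMap.compSubConstCLM ℂ c
    (SchwartzMap.compCLMOfContinuousLinearEquiv ℂ (timeScalePiEquiv d m ν hν).symm G)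

/-- Values of the pushed-forward test function. [folklore] -/
theorem pushTest_apply (ν : ℝ) (hν : ν ≠ 0) (c : Fin m → SpaceTime d) (G : 𝓢((Fin m → SpaceTime d), ℂ))
    (y : Fin m → SpaceTime d) :
    pushTest ν hν c G y = ((|ν ^ m|⁻¹ : ℝ) : ℂ) * G (timeScalePi d m ν⁻¹ (y - c)) := by
  simp [pushTest, SchwartzMap.compSubConstCLM_apply, SchwartzMap.compCLMOfContinuousLinearEquiv_apply]

/-- The pushed-forward test function on the affine image: `g(A u) = |ν^m|⁻¹ G(u)`. [folklore] -/
theorem pushTest_apply_affine (ν : ℝ) (hν : ν ≠ 0) (c : Fin m → SpaceTime d) (G : 𝓢((Fin m → SpaceTime d), ℂ))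
    (u : Fin m → SpaceTime d) :
    pushTest ν hν c G (timeScalePi d m ν u + c) = ((|ν ^ m|⁻¹ : ℝ) : ℂ) * G u := by
  rw [pushTest_apply, add_sub_cancel_right]
  congr 2
  exact (timeScalePiEquiv d m ν hν).symm_apply_apply u

/-- The support of the pushed-forward test function lies in the affine image of the support. [folklore] -/
theorem tsupport_pushTest_subset (ν : ℝ) (hν : ν ≠ 0) (c : Fin m → SpaceTime d)
    (G : 𝓢((Fin m → SpaceTime d), ℂ)) (hGc : HasCompactSupport (G : (Fin m → SpaceTime d) → ℂ)) :
    tsupport (pushTest ν hν c G : (Fin m → SpaceTime d) → ℂ) ⊆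
      (fun u => timeScalePi d m ν u + c) '' tsupport (G : (Fin m → SpaceTime d) → ℂ) := by
  have himg : IsClosed ((fun u => timeScalePi d m ν u + c) '' tsupport (G : (Fin m → SpaceTime d) → ℂ)) :=
    (hGc.isCompact.image ((timeScalePi d m ν).continuous.add continuous_const)).isClosed
  refine closure_minimal (fun y hy => ?_) himg
  rw [Function.mem_support, pushTest_apply] at hy
  have hG : G (timeScalePi d m ν⁻¹ (y - c)) ≠ 0 := fun h0 => hy (by rw [h0, mul_zero])
  refine ⟨timeScalePi d m ν⁻¹ (y - c), subset_tsupport _ hG, ?_⟩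
  have := (timeScalePiEquiv d m ν hν).apply_symm_apply (y - c)
  simp only [timeScalePiEquiv_apply, timeScalePiEquiv_symm_apply] at this
  show timeScalePi d m ν (timeScalePi d m ν⁻¹ (y - c)) + c = y
  rw [this, sub_add_cancel]

/-- The pushed-forward test function has compact support. [folklore] -/
theorem hasCompactSupport_pushTest (ν : ℝ) (hν : ν ≠ 0) (c : Fin m → SpaceTime d)
    (G : 𝓢((Fin m → SpaceTime d), ℂ)) (hGc : HasCompactSupport (G : (Fin m → SpaceTime d) → ℂ)) :
    HasCompactSupport (pushTest ν hν c G : (Fin m → SpaceTime d) → ℂ) :=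
  (hGc.isCompact.image ((timeScalePi d m ν).continuous.add continuous_const)).of_isClosed_subset
    (isClosed_tsupport _) (tsupport_pushTest_subset ν hν c G hGc)

/-- **The pushed-forward ray weight is time-ordered** for small `ν > 0`, `r ≥ 0`. [folklore] -/
theorem isTimeOrdered_pushTest {s r R ν : ℝ} (hν : 0 < ν) (hνs : 2 * (R + 1) * |ν| < s) (hr : 0 ≤ r)
    (hR : 0 ≤ R) (G : 𝓢((Fin m → SpaceTime d), ℂ)) (hGc : HasCompactSupport (G : (Fin m → SpaceTime d) → ℂ))
    (hGR : ∀ u ∈ tsupport (G : (Fin m → SpaceTime d) → ℂ), ∀ k, |u k 0| ≤ R) :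
    IsTimeOrdered (pushTest ν hν.ne' (rayShiftVec d m s r) G) := by
  intro y hy
  obtain ⟨u, hu, rfl⟩ := tsupport_pushTest_subset ν hν.ne' _ G hGc hy
  exact timeScalePi_add_rayShiftVec_mem_timeOrderedRegion hνs hr hR (hGR u hu)

/-- The nice generator of the pushed-forward ray weight. [folklore] -/
def pushGen {s r R ν : ℝ} (hν : 0 < ν) (hνs : 2 * (R + 1) * |ν| < s) (hr : 0 ≤ r) (hR : 0 ≤ R)
    (G : 𝓢((Fin m → SpaceTime d), ℂ)) (hGc : HasCompactSupport (G : (Fin m → SpaceTime d) → ℂ))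
    (hGR : ∀ u ∈ tsupport (G : (Fin m → SpaceTime d) → ℂ), ∀ k, |u k 0| ≤ R) :
    Literature.MathematicalPhysics.QuantumLattice.SchwingerFamily.PosGen (d + 1) :=
  ⟨m, ⟨pushTest ν hν.ne' (rayShiftVec d m s r) G,
    (isTimeOrdered_pushTest hν hνs hr hR G hGc hGR).isPositiveTimeMulti⟩⟩

/-- The generator of the pushed-forward ray weight is nice. [folklore] -/
theorem isNiceGen_pushGen {s r R ν : ℝ} (hν : 0 < ν) (hνs : 2 * (R + 1) * |ν| < s) (hr : 0 ≤ r) (hR : 0 ≤ R)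
    (G : 𝓢((Fin m → SpaceTime d), ℂ)) (hGc : HasCompactSupport (G : (Fin m → SpaceTime d) → ℂ))
    (hGR : ∀ u ∈ tsupport (G : (Fin m → SpaceTime d) → ℂ), ∀ k, |u k 0| ≤ R) :
    IsNiceGen (pushGen hν hνs hr hR G hGc hGR) :=
  ⟨isTimeOrdered_pushTest hν hνs hr hR G hGc hGR, hasCompactSupport_pushTest ν hν.ne' _ G hGc⟩

variable {𝔚 : (n : ℕ) → (Fin n → Fin (d + 1) → ℂ) → ℂ}

/-- **The Euclidean end, second slot**: at `μ = iν` the smeared kernel of the deformed ray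
smearing equals that of the Euclidean smearing of the pushed-forward weight (change of variables
`y = A u`). [folklore] -/
theorem smKernel_rayFam_eval_I_mul_right {s r R ν : ℝ} (hr : 0 ≤ r) (hR : 0 ≤ R) (hν : 0 < ν)
    (hνs : 2 * (R + 1) * |ν| < s) (G : 𝓢((Fin m → SpaceTime d), ℂ))
    (hGc : HasCompactSupport (G : (Fin m → SpaceTime d) → ℂ))
    (hGR : ∀ u ∈ tsupport (G : (Fin m → SpaceTime d) → ℂ), ∀ k, |u k 0| ≤ R) (τ : Smearing d n) :
    smKernel 𝔚 ⟨n, τ⟩ ⟨m, (rayFam s r R hr hR G G.continuous hGc hGR).eval (I * ν)⟩ =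
      smKernel 𝔚 ⟨n, τ⟩ (Smearing.ofGen (pushGen hν hνs hr hR G hGc hGR) (isNiceGen_pushGen hν hνs hr hR G hGc hGR)) := by
  have hμ : I * (ν : ℂ) ∈ (rayFam s r R hr hR G G.continuous hGc hGR).V := I_mul_mem_rayFamV hνs
  rw [smKernel_apply, Smearing.ofGen, smKernel_apply]
  congr 1; funext u
  simp only [SmearingFamily.eval_φ _ hμ, SmearingFamily.eval_w _ hμ, Smearing.ofEuclid_φ, Smearing.ofEuclid_w]
  set A : (Fin m → SpaceTime d) → (Fin m → SpaceTime d) := fun u' => timeScalePi d m ν u' + rayShiftVec d m s r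
    with hA
  set F : (Fin m → SpaceTime d) → ℂ := fun y => osKernel 𝔚 ⟨n, τ.φ u⟩ ⟨m, euclideanPoint y⟩ *
    (conj (τ.w u) * pushTest ν hν.ne' (rayShiftVec d m s r) G y) with hF
  have hcv : ∫ u', F (A u') = |ν ^ m|⁻¹ • ∫ y, F y := integral_comp_timeScalePi_add hν.ne' _ F
  have hpos : 0 < |ν ^ m| := abs_pos.2 (pow_ne_zero _ hν.ne')
  have h1 : ∫ y, F y = |ν ^ m| • ∫ u', F (A u') := by
    rw [hcv, smul_smul, mul_inv_cancel₀ hpos.ne', one_smul]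
  change ∫ u', osKernel 𝔚 ⟨n, τ.φ u⟩ ⟨m, rayFamφ d m s r (I * ν) u'⟩ * (conj (τ.w u) * G u') = ∫ y, F y
  rw [h1, ← integral_smul]
  congr 1; funext u'
  simp only [hF, hA, pushTest_apply_affine, rayFamφ_I_mul, real_smul, Complex.ofReal_inv]
  have hne : ((|ν ^ m| : ℝ) : ℂ) ≠ 0 := by exact_mod_cast hpos.ne'
  field_simp

/-- **The Euclidean end, first slot.** [folklore] -/
theorem smKernel_rayFam_eval_I_mul_left {s r R ν : ℝ} (hr : 0 ≤ r) (hR : 0 ≤ R) (hν : 0 < ν)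
    (hνs : 2 * (R + 1) * |ν| < s) (G : 𝓢((Fin m → SpaceTime d), ℂ))
    (hGc : HasCompactSupport (G : (Fin m → SpaceTime d) → ℂ))
    (hGR : ∀ u ∈ tsupport (G : (Fin m → SpaceTime d) → ℂ), ∀ k, |u k 0| ≤ R) (τ : Smearing d n) :
    smKernel 𝔚 ⟨m, (rayFam s r R hr hR G G.continuous hGc hGR).eval (I * ν)⟩ ⟨n, τ⟩ =
      smKernel 𝔚 (Smearing.ofGen (pushGen hν hνs hr hR G hGc hGR) (isNiceGen_pushGen hν hνs hr hR G hGc hGR)) ⟨n, τ⟩ := by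
  have hμ : I * (ν : ℂ) ∈ (rayFam s r R hr hR G G.continuous hGc hGR).V := I_mul_mem_rayFamV hνs
  rw [smKernel_apply, Smearing.ofGen, smKernel_apply]
  simp only [SmearingFamily.eval_φ _ hμ, SmearingFamily.eval_w _ hμ, Smearing.ofEuclid_φ, Smearing.ofEuclid_w]
  set A : (Fin m → SpaceTime d) → (Fin m → SpaceTime d) := fun u => timeScalePi d m ν u + rayShiftVec d m s r
    with hA
  set F : (Fin m → SpaceTime d) → ℂ := fun y => ∫ u', osKernel 𝔚 ⟨m, euclideanPoint y⟩ ⟨n, τ.φ u'⟩ *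
    (conj (pushTest ν hν.ne' (rayShiftVec d m s r) G y) * τ.w u') with hF
  have hcv : ∫ u, F (A u) = |ν ^ m|⁻¹ • ∫ y, F y := integral_comp_timeScalePi_add hν.ne' _ F
  have hpos : 0 < |ν ^ m| := abs_pos.2 (pow_ne_zero _ hν.ne')
  have h1 : ∫ y, F y = |ν ^ m| • ∫ u, F (A u) := by
    rw [hcv, smul_smul, mul_inv_cancel₀ hpos.ne', one_smul]
  change ∫ u, ∫ u', osKernel 𝔚 ⟨m, rayFamφ d m s r (I * ν) u⟩ ⟨n, τ.φ u'⟩ * (conj (G u) * τ.w u') = ∫ y, F y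
  rw [h1, ← integral_smul]
  congr 1; funext u
  simp only [hF, hA, pushTest_apply_affine, rayFamφ_I_mul, real_smul, Complex.ofReal_inv, map_mul,
    map_inv₀, Complex.conj_ofReal, ← integral_const_mul]
  congr 1; funext u'
  have hne : ((|ν ^ m| : ℝ) : ℂ) ≠ 0 := by exact_mod_cast hpos.ne'
  field_simp

/-- **At `μ = 1` the deformed smearing has the kernels of the ray smearing** (first slot). [folklore] -/
theorem smKernel_rayFam_eval_one_left {s R : ℝ} (hs : 0 < s) (hR : 0 ≤ R)
    (G : 𝓢((Fin m → SpaceTime d), ℂ)) (hGc : HasCompactSupport (G : (Fin m → SpaceTime d) → ℂ))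
    (hGR : ∀ u ∈ tsupport (G : (Fin m → SpaceTime d) → ℂ), ∀ k, |u k 0| ≤ R) (τ : Smearing d n) :
    smKernel 𝔚 ⟨m, (rayFam s 0 R le_rfl hR G G.continuous hGc hGR).eval 1⟩ ⟨n, τ⟩ =
      smKernel 𝔚 ⟨m, Smearing.ofRay hs G G.continuous hGc⟩ ⟨n, τ⟩ := by
  have hμ : (1 : ℂ) ∈ (rayFam s 0 R le_rfl hR G G.continuous hGc hGR).V := by
    change (1 : ℂ) ∈ rayFamV s R
    simp [rayFamV, hs]
  rw [smKernel_apply, smKernel_apply]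
  simp only [SmearingFamily.eval_φ _ hμ, SmearingFamily.eval_w _ hμ, Smearing.ofRay_φ, Smearing.ofRay_w]
  change ∫ u, ∫ u', osKernel 𝔚 ⟨m, rayFamφ d m s 0 1 u⟩ ⟨n, τ.φ u'⟩ * (conj (G u) * τ.w u') = _
  simp only [rayFamφ_one_zero]

/-- **At `μ = 1` the deformed smearing has the kernels of the ray smearing** (second slot). [folklore] -/
theorem smKernel_rayFam_eval_one_right {s R : ℝ} (hs : 0 < s) (hR : 0 ≤ R)
    (G : 𝓢((Fin m → SpaceTime d), ℂ)) (hGc : HasCompactSupport (G : (Fin m → SpaceTime d) → ℂ))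
    (hGR : ∀ u ∈ tsupport (G : (Fin m → SpaceTime d) → ℂ), ∀ k, |u k 0| ≤ R) (τ : Smearing d n) :
    smKernel 𝔚 ⟨n, τ⟩ ⟨m, (rayFam s 0 R le_rfl hR G G.continuous hGc hGR).eval 1⟩ =
      smKernel 𝔚 ⟨n, τ⟩ ⟨m, Smearing.ofRay hs G G.continuous hGc⟩ := by
  have hμ : (1 : ℂ) ∈ (rayFam s 0 R le_rfl hR G G.continuous hGc hGR).V := by
    change (1 : ℂ) ∈ rayFamV s R
    simp [rayFamV, hs]
  rw [smKernel_apply, smKernel_apply]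
  simp only [SmearingFamily.eval_φ _ hμ, SmearingFamily.eval_w _ hμ, Smearing.ofRay_φ, Smearing.ofRay_w]
  change ∫ u, ∫ u', osKernel 𝔚 ⟨n, τ.φ u⟩ ⟨m, rayFamφ d m s 0 1 u'⟩ * (conj (τ.w u) * G u') = _
  simp only [rayFamφ_one_zero]

/-- A compactly supported weight has a bound `R ≥ 0` on the times of its support. [folklore] -/
theorem exists_abs_time_le_of_hasCompactSupport {G : (Fin m → SpaceTime d) → ℂ} (hGc : HasCompactSupport G) :
    ∃ R : ℝ, 0 ≤ R ∧ ∀ u ∈ tsupport G, ∀ k, |u k 0| ≤ R := by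
  obtain ⟨R, hR⟩ := hGc.isCompact.isBounded.subset_closedBall 0
  refine ⟨max R 0, le_max_right _ _, fun u hu k => ?_⟩
  have h1 : ‖u‖ ≤ max R 0 := (mem_closedBall_zero_iff.1 (hR hu)).trans (le_max_left _ _)
  have h2 : |u k 0| ≤ ‖u k‖ := by
    have := (PiLp.norm_apply_le (p := 2) (u k) 0 : ‖u k 0‖ ≤ ‖u k‖)
    simpa [Real.norm_eq_abs] using this
  exact h2.trans ((norm_le_pi_norm u k).trans h1)

variable [NeZero d] {S : SchwingerFamily (EuclideanSpace ℝ (Fin (d + 1)))}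

open Literature.MathematicalPhysics.QuantumLattice.SchwingerFamily (OSSpace OSHilbert PosGen genPairing)
open Literature.MathematicalPhysics.QuantumLattice.SchwingerFamily.OSSpace

/-- **The Glaser vector at the Euclidean end is the basis vector of the pushed-forward weight.** [folklore] -/
theorem GlaserHyp.glaserVec_rayFam_eval_I_mul (h : GlaserHyp S 𝔚) (hE2 : S.IsOSReflectionPositive)
    {s r R ν : ℝ} (hr : 0 ≤ r) (hR : 0 ≤ R) (hν : 0 < ν) (hνs : 2 * (R + 1) * |ν| < s)
    (G : 𝓢((Fin m → SpaceTime d), ℂ)) (hGc : HasCompactSupport (G : (Fin m → SpaceTime d) → ℂ))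
    (hGR : ∀ u ∈ tsupport (G : (Fin m → SpaceTime d) → ℂ), ∀ k, |u k 0| ≤ R) :
    h.glaserVec hE2 ⟨m, (rayFam s r R hr hR G G.continuous hGc hGR).eval (I * ν)⟩ =
      ι S hE2 (δ S hE2 (pushGen hν hνs hr hR G hGc hGR)) := by
  rw [← h.glaserVec_ofGen hE2 _ (isNiceGen_pushGen hν hνs hr hR G hGc hGR)]
  exact h.glaserVec_congr hE2 fun _ _ => smKernel_rayFam_eval_I_mul_left hr hR hν hνs G hGc hGR _

/-- **The Glaser vector at `μ = 1` is the Glaser vector of the ray smearing.** [folklore] -/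
theorem GlaserHyp.glaserVec_rayFam_eval_one (h : GlaserHyp S 𝔚) (hE2 : S.IsOSReflectionPositive)
    {s R : ℝ} (hs : 0 < s) (hR : 0 ≤ R)
    (G : 𝓢((Fin m → SpaceTime d), ℂ)) (hGc : HasCompactSupport (G : (Fin m → SpaceTime d) → ℂ))
    (hGR : ∀ u ∈ tsupport (G : (Fin m → SpaceTime d) → ℂ), ∀ k, |u k 0| ≤ R) :
    h.glaserVec hE2 ⟨m, (rayFam s 0 R le_rfl hR G G.continuous hGc hGR).eval 1⟩ =
      h.glaserVec hE2 ⟨m, Smearing.ofRay hs G G.continuous hGc⟩ :=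
  h.glaserVec_congr hE2 fun _ _ => smKernel_rayFam_eval_one_left hs hR G hGc hGR _

end RayFamily


end Literature.MathematicalPhysics.QuantumFieldTheory
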